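import Mathlib
import Literature.NumberTheory.LFunctions.TaoLogElliottTheorem23Proofs
import Literature.NumberTheory.LFunctions.TaoLogChowlaProofs
import Literature.NumberTheory.LFunctions.MatomakiRadziwillTaoTheorem13
import Literature.NumberTheory.QuadraticFields.TwistedDedekindZeta
import HarnessLib

/-!
# Teräväinen 2024, §5.4, major arcs for `g = λ`: Matomäki–Radziwiłł for `λχ` in short intervals

Support file (everything PROVED; no definitions, no named facts) towards the named fact
`Literature.NumberTheory.Sieve.teravainen2024_cor_2_1` (J. Teräväinen, *On the Liouville function
at polynomial arguments*, Amer. J. Math. 146 (2024) = arXiv:2010.07924, Corollary 2.1 ⊂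
Theorem 2.6 for `g_j = λ`, proved in §5). In Case 1 (major arcs) of the proof of Proposition 5.4
(§5.4, p. 14), after expanding the rational polynomial phase and the progression into Dirichlet
characters ((5.17)–(5.18)), the paper invokes

> "Recall that we are working under the non-pretentiousness assumption `𝔻(g,ξ;∞) = ∞`. Since `g`
> takes values in `μ_q`, we can boost this assumption to `inf_{|t|≤x} 𝔻(g, ξ(n)n^{it}; x) → ∞`
> ((5.19)) for all `ξ (mod R²Q)` […]. By (5.19) and the Matomäki–Radziwiłł theorem, in the form of
> [MRT, *An averaged form of Chowla's conjecture*], for `X` large enough in terms of `H'` we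
> conclude that `|𝔼_{y≤n≤y+H'} g(n)ξ(n)| ≪ (log log H')/log H'` for all natural numbers `y ≤ X`,
> apart from `≪ X (log log H')/log H'` exceptions."

For `g = λ` both inputs are theorems of the tree: (5.19) is Matomäki–Radziwiłł–Tao 2015, (1.12)
(`Literature.NumberTheory.LFunctions.MatomakiRadziwillTao2015_liouvilleDistLowerBound_holds`:
`inf_{|t|≤X} 𝔻(λ, ξ n^{it}; X)² ≥ (1/3 - ε) log log X - C` uniformly in `ξ (mod q)`,
`q ≤ log^{1/125} X`), and "the Matomäki–Radziwiłł theorem in the form of [MRT]" is MRT 2015,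
Theorem 1.7 (`Literature.NumberTheory.LFunctions.MatomakiRadziwillTao2015_theorem17_holds`, for
every `1`-bounded multiplicative `g`, with the non-pretentiousness `M(g; X, Q)`,
`Q = min(log^{1/125} X, log⁵ H)`). This file combines them for `g = λξ` (`ξ` a Dirichlet character
mod `r`):

* `Teravainen2024.pretentiousDistSq_liouville_mul_char` — the distance of `λξ` from `ψ(n)n^{it}`
  (`ψ` mod `q`) is the distance of `λ` from `(ξ̄ψ)(n) n^{it}`, `ξ̄ψ` the product character mod `rq`
  (values by the tree's `Literature.NumberTheory.QuadraticFields.Quadratic.changeLevel_mul_changeLevel_natCast`);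
* `Teravainen2024.liouville_mul_char_shortSum_integral_le` — **MR for `λξ` with a linear phase**:
  there is `C = C(r, ξ)` with
  `∫_0^X |∑_{x≤n≤x+H} λ(n)ξ(n)e(αn)| dx ≤ C (log log H/log H + log^{-1/700} X) H X`
  for all `10 ≤ H ≤ X` with `r log⁵ H ≤ log^{1/125} X` (the level of `ξ̄ψ` must stay in the range
  of (1.12); this is "`X` large enough in terms of `H'`") and all real `α`;
* `Teravainen2024.liouville_mul_char_shortSum_integral_small` — the qualitative form used in
  print: for every `δ > 0`, all `H ≥ H₀(δ, r, ξ)` and `X ≥ X₀(H)`, the integral is `≤ δ H X`.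

## References
* J. Teräväinen, Amer. J. Math. 146 (2024), no. 4, 1115–1167, §5.4, proof of Proposition 5.4,
  Case 1, (5.19) and the display following it (arXiv:2010.07924, p. 14). [Teravainen2024]
* K. Matomäki, M. Radziwiłł, T. Tao, Algebra Number Theory 9 (2015), Theorem 1.7 and (1.12)
  (tree: `MatomakiRadziwillTaoTheorem17.lean`, `TaoLogChowla.lean`, both discharged).
-/

noncomputable section

open Finset Complex Filter MeasureTheory
open scoped ComplexConjugate

namespace Literature.NumberTheory.Sieve

namespace Teravainen2024

open Literature.NumberTheory.LFunctions

/-! ### Dirichlet characters: conjugate = inverse -/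

/-- For a Dirichlet character with complex values, `χ⁻¹(a) = conj χ(a)` for every residue `a`
(both vanish at non-units). [folklore] -/
theorem inv_apply_eq_conj_apply {r : ℕ} (χ : DirichletCharacter ℂ r) (a : ZMod r) :
    χ⁻¹ a = conj (χ a) := by
  rw [MulChar.inv_apply_eq_inv']
  by_cases h : IsUnit a
  · obtain ⟨u, rfl⟩ := h
    exact Complex.inv_eq_conj (χ.unit_norm_eq_one u)
  · rw [MulChar.map_nonunit χ h]
    simp

/-! ### `λξ` as a `1`-bounded multiplicative function, and its pretentious distances -/

section LiouvilleTwist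

variable {r : ℕ} [NeZero r] (ξ : DirichletCharacter ℂ r) {g : ArithmeticFunction ℂ}

omit [NeZero r] in
/-- `λξ` is multiplicative. [folklore] -/
theorem isMultiplicative_of_eq_liouville_mul_char
    (hg : ∀ n : ℕ, g n = (ArithmeticFunction.liouville : ArithmeticFunction ℂ) n * ξ n) :
    g.IsMultiplicative := by
  refine ⟨?_, ?_⟩
  · rw [hg]
    simp [isMultiplicative_liouville_complex.map_one]
  · intro m n hmn
    rw [hg, hg, hg, isMultiplicative_liouville_complex.map_mul_of_coprime hmn]
    push_cast
    rw [map_mul]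
    ring

omit [NeZero r] in
/-- `λξ` is `1`-bounded. [folklore] -/
theorem norm_le_one_of_eq_liouville_mul_char
    (hg : ∀ n : ℕ, g n = (ArithmeticFunction.liouville : ArithmeticFunction ℂ) n * ξ n) (n : ℕ) :
    ‖g n‖ ≤ 1 := by
  rw [hg, norm_mul]
  have h1 := norm_liouville_complex_le_one n
  have h2 := ξ.norm_le_one (n : ZMod r)
  have h0 := norm_nonneg ((ArithmeticFunction.liouville : ArithmeticFunction ℂ) n)
  nlinarith

/-- **The distances of `λξ`**: for `ψ (mod q)` and real `t`,
`𝔻(λξ, ψ(n)n^{it}; X)² = 𝔻(λ, (ξ̄ψ)(n) n^{it}; X)²` with `ξ̄ψ = ξ⁻¹ψ` the product character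
modulo `rq`. [cite: Teravainen2024, §5.4 (5.19) for g = λ] -/
theorem pretentiousDistSq_liouville_mul_char
    (hg : ∀ n : ℕ, g n = (ArithmeticFunction.liouville : ArithmeticFunction ℂ) n * ξ n)
    {q : ℕ} [NeZero q] (ψ : DirichletCharacter ℂ q) (t X : ℝ) :
    Sieve.pretentiousDistSq g (Sieve.twistedChar ψ t) X =
      Sieve.pretentiousDistSq (ArithmeticFunction.liouville : ArithmeticFunction ℂ)
        (Sieve.twistedChar (DirichletCharacter.changeLevel (dvd_mul_right r q) ξ⁻¹ *
          DirichletCharacter.changeLevel (dvd_mul_left q r) ψ) t) X := by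
  unfold Sieve.pretentiousDistSq
  refine Finset.sum_congr rfl fun p _ => ?_
  congr 3
  simp only [Sieve.twistedChar]
  rw [Literature.NumberTheory.QuadraticFields.Quadratic.changeLevel_mul_changeLevel_natCast,
    inv_apply_eq_conj_apply, hg]
  simp only [map_mul, Complex.conj_conj]
  ring

end LiouvilleTwist

/-! ### Matomäki–Radziwiłł for `λξ e(α·)` in short intervals -/

/-- **Matomäki–Radziwiłł for `λξ` with a linear phase** (MRT 2015, Theorem 1.7 for `g = λξ` +
(1.12)): for a Dirichlet character `ξ` mod `r` there is `C` such that for all `10 ≤ H ≤ X` with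
`r · log⁵ H ≤ log^{1/125} X` and all real `α`,
`∫_0^X |∑_{x≤n≤x+H} λ(n) ξ(n) e(αn)| dx ≤ C (log log H / log H + 1/log^{1/700} X) H X`.
[cite: Teravainen2024, §5.4 (proof of Proposition 5.4, Case 1: (5.19) and the display after it),
for g = λ] -/
theorem liouville_mul_char_shortSum_integral_le {r : ℕ} [NeZero r] (ξ : DirichletCharacter ℂ r) :
    ∃ C : ℝ, ∀ H X : ℝ, 10 ≤ H → H ≤ X →
      (r : ℝ) * Real.log H ^ (5 : ℝ) ≤ Real.log X ^ (1 / 125 : ℝ) → ∀ α : ℝ,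
      ∫ x in (0 : ℝ)..X, ‖∑ n ∈ Finset.Icc ⌈x⌉₊ ⌊x + H⌋₊,
          (ArithmeticFunction.liouville : ArithmeticFunction ℂ) n * ξ n *
            Complex.exp (2 * Real.pi * Complex.I * (α : ℂ) * (n : ℂ))‖
        ≤ C * (Real.log (Real.log H) / Real.log H + 1 / Real.log X ^ (1 / 700 : ℝ)) * H * X := by
  obtain ⟨C₁, hC₁⟩ := MatomakiRadziwillTao2015_theorem17_holds
  obtain ⟨C₂, X₀, h12⟩ :=
    MatomakiRadziwillTao2015_liouvilleDistLowerBound_holds.pretentiousDistSq_ge (1 / 6) (by norm_num)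
  set L : ArithmeticFunction ℂ := (ArithmeticFunction.liouville : ArithmeticFunction ℂ) with hL
  -- the arithmetic function `λξ`
  set g : ArithmeticFunction ℂ := ⟨fun n => L n * ξ n, by simp⟩ with hg_def
  have hg : ∀ n : ℕ, g n = L n * ξ n := fun n => rfl
  have hgm : g.IsMultiplicative := isMultiplicative_of_eq_liouville_mul_char ξ hg
  have hg1 : ∀ n, ‖g n‖ ≤ 1 := norm_le_one_of_eq_liouville_mul_char ξ hg
  set X₁ : ℝ := max X₀ (Real.exp (Real.exp 1)) with hX₁
  have hX₁e : Real.exp (Real.exp 1) ≤ X₁ := le_max_right _ _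
  have hX₁pos : 0 < X₁ := lt_of_lt_of_le (Real.exp_pos _) hX₁e
  have hlogX₁ : 1 ≤ Real.log X₁ := by
    have : Real.exp 1 ≤ Real.log X₁ := by
      rw [← Real.log_exp (Real.exp 1)]; exact Real.log_le_log (Real.exp_pos _) hX₁e
    linarith [Real.add_one_le_exp (1 : ℝ)]
  set C₁' : ℝ := max C₁ 0 with hC₁'
  set K : ℝ := max (C₁' * (Real.exp (C₂ / 20) + 1)) (2 * Real.log X₁ ^ (1 / 700 : ℝ)) with hK
  refine ⟨K, fun H X hH hHX hlev α => ?_⟩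
  have hH0 : (0 : ℝ) < H := by linarith
  have hX0 : (0 : ℝ) < X := by linarith
  have hlogX : 0 < Real.log X := Real.log_pos (by linarith)
  have hlogH1 : 1 ≤ Real.log H := by
    rw [← Real.log_exp 1]
    exact Real.log_le_log (Real.exp_pos 1) (by have := Real.exp_one_lt_three; linarith)
  have hrate0 : 0 ≤ Real.log (Real.log H) / Real.log H + 1 / Real.log X ^ (1 / 700 : ℝ) := by
    have : 0 ≤ Real.log (Real.log H) := Real.log_nonneg hlogH1
    positivity
  have hrate1 : 1 / Real.log X ^ (1 / 700 : ℝ)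
      ≤ Real.log (Real.log H) / Real.log H + 1 / Real.log X ^ (1 / 700 : ℝ) := by
    have : 0 ≤ Real.log (Real.log H) / Real.log H := div_nonneg (Real.log_nonneg hlogH1) (by linarith)
    linarith
  -- the integrand of Theorem 1.7 for `g = λξ` is ours
  have hint : ∀ x : ℝ, (∑ n ∈ Finset.Icc ⌈x⌉₊ ⌊x + H⌋₊,
      g n * Complex.exp (2 * Real.pi * Complex.I * (α : ℂ) * (n : ℂ)))
      = ∑ n ∈ Finset.Icc ⌈x⌉₊ ⌊x + H⌋₊,
          L n * ξ n * Complex.exp (2 * Real.pi * Complex.I * (α : ℂ) * (n : ℂ)) := fun x => rfl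
  rcases le_or_gt X₁ X with hXX₁ | hXX₁
  · -- large `X`: Theorem 1.7 and (1.12)
    have hXX₀ : X₀ ≤ X := le_trans (le_max_left _ _) hXX₁
    have hlogX1 : 1 ≤ Real.log X := hlogX₁.trans (Real.log_le_log hX₁pos hXX₁)
    have h1 := hC₁ g hgm hg1 X H hH hHX α
    -- lower bound for `M(λξ; X, Q)`
    set Q : ℝ := min (Real.log X ^ (1 / 125 : ℝ)) (Real.log H ^ (5 : ℝ)) with hQ
    have hQ1 : 1 ≤ Q := by
      rw [hQ, le_min_iff]
      exact ⟨Real.one_le_rpow hlogX1 (by norm_num), Real.one_le_rpow hlogH1 (by norm_num)⟩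
    have hQle : Q ≤ Real.log H ^ (5 : ℝ) := min_le_right _ _
    have hr1 : (1 : ℝ) ≤ r := by exact_mod_cast Nat.one_le_iff_ne_zero.mpr (NeZero.ne r)
    have hM : (1 / 3 - 1 / 6) * Real.log (Real.log X) - C₂ ≤ Sieve.nonpretentiousness g X Q := by
      unfold Sieve.nonpretentiousness Sieve.charNonpretentiousness
      haveI : Nonempty (Set.Icc 1 ⌊Q⌋₊) :=
        ⟨⟨1, Set.mem_Icc.2 ⟨le_rfl, Nat.le_floor (by exact_mod_cast hQ1)⟩⟩⟩
      refine le_ciInf fun q => ?_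
      haveI : Nonempty (DirichletCharacter ℂ (q : ℕ)) := ⟨1⟩
      refine le_ciInf fun ψ => ?_
      haveI : Nonempty (Set.Icc (-X) X) := ⟨⟨0, Set.mem_Icc.2 ⟨by linarith, hX0.le⟩⟩⟩
      refine le_ciInf fun t => ?_
      have hq := q.2
      rw [Set.mem_Icc] at hq
      haveI : NeZero (q : ℕ) := ⟨by omega⟩
      rw [pretentiousDistSq_liouville_mul_char ξ hg]
      refine h12 X hXX₀ (r * q) _ t (Nat.one_le_iff_ne_zero.mpr (mul_ne_zero (NeZero.ne r) (by omega)))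
        ?_ (abs_le.2 (Set.mem_Icc.1 t.2))
      have hqQ : ((q : ℕ) : ℝ) ≤ Real.log H ^ (5 : ℝ) := by
        calc ((q : ℕ) : ℝ) ≤ ⌊Q⌋₊ := by exact_mod_cast hq.2
          _ ≤ Q := Nat.floor_le (by linarith)
          _ ≤ Real.log H ^ (5 : ℝ) := hQle
      calc ((r * q : ℕ) : ℝ) = (r : ℝ) * (q : ℕ) := by push_cast; ring
        _ ≤ (r : ℝ) * Real.log H ^ (5 : ℝ) := mul_le_mul_of_nonneg_left hqQ (by linarith)
        _ ≤ Real.log X ^ (1 / 125 : ℝ) := hlev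
    have hexp : Real.exp (-(Sieve.nonpretentiousness g X Q) / 20) ≤
        Real.exp (C₂ / 20) * (1 / Real.log X ^ (1 / 700 : ℝ)) := by
      have h2 : -(Sieve.nonpretentiousness g X Q) / 20 ≤
          C₂ / 20 + (-(1 / 120)) * Real.log (Real.log X) := by
        linarith
      calc Real.exp (-(Sieve.nonpretentiousness g X Q) / 20)
          ≤ Real.exp (C₂ / 20 + (-(1 / 120)) * Real.log (Real.log X)) := Real.exp_le_exp.2 h2
        _ = Real.exp (C₂ / 20) * Real.log X ^ (-(1 / 120) : ℝ) := by
            rw [Real.exp_add, Real.rpow_def_of_pos hlogX, mul_comm (Real.log (Real.log X))]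
        _ ≤ Real.exp (C₂ / 20) * Real.log X ^ (-(1 / 700) : ℝ) := by
            apply mul_le_mul_of_nonneg_left _ (Real.exp_pos _).le
            exact Real.rpow_le_rpow_of_exponent_le hlogX1 (by norm_num)
        _ = Real.exp (C₂ / 20) * (1 / Real.log X ^ (1 / 700 : ℝ)) := by
            rw [Real.rpow_neg hlogX.le, inv_eq_one_div]
    have hHX0 : 0 ≤ (H : ℝ) * X := by positivity
    set E : ℝ := Real.exp (-(Sieve.nonpretentiousness g X Q) / 20)
      + Real.log (Real.log H) / Real.log H + 1 / Real.log X ^ (1 / 700 : ℝ) with hE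
    have hE0 : 0 ≤ E := by
      have := Real.exp_pos (-(Sieve.nonpretentiousness g X Q) / 20); rw [hE]; linarith
    have h1' : ∫ x in (0 : ℝ)..X, ‖∑ n ∈ Finset.Icc ⌈x⌉₊ ⌊x + H⌋₊,
        L n * ξ n * Complex.exp (2 * Real.pi * Complex.I * (α : ℂ) * (n : ℂ))‖
          ≤ C₁' * E * H * X := by
      simp only [hint] at h1
      refine h1.trans ?_
      have e : ∀ c : ℝ, c * E * H * X = c * (E * (H * X)) := fun c => by ring
      rw [e, e]
      exact mul_le_mul_of_nonneg_right (le_max_left _ _) (mul_nonneg hE0 hHX0)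
    calc ∫ x in (0 : ℝ)..X, ‖∑ n ∈ Finset.Icc ⌈x⌉₊ ⌊x + H⌋₊,
          L n * ξ n * Complex.exp (2 * Real.pi * Complex.I * (α : ℂ) * (n : ℂ))‖
        ≤ C₁' * E * H * X := h1'
      _ ≤ C₁' * ((Real.exp (C₂ / 20) + 1)
            * (Real.log (Real.log H) / Real.log H + 1 / Real.log X ^ (1 / 700 : ℝ))) * H * X := by
          have hC0 : 0 ≤ C₁' := le_max_right _ _
          apply mul_le_mul_of_nonneg_right _ hX0.le
          apply mul_le_mul_of_nonneg_right _ hH0.le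
          apply mul_le_mul_of_nonneg_left _ hC0
          rw [hE]
          have := mul_le_mul_of_nonneg_left hrate1 (Real.exp_pos (C₂ / 20)).le
          nlinarith [hexp, hrate0]
      _ = (C₁' * (Real.exp (C₂ / 20) + 1))
            * (Real.log (Real.log H) / Real.log H + 1 / Real.log X ^ (1 / 700 : ℝ)) * H * X := by
          ring
      _ ≤ K * (Real.log (Real.log H) / Real.log H + 1 / Real.log X ^ (1 / 700 : ℝ)) * H * X := by
          apply mul_le_mul_of_nonneg_right _ hX0.le
          apply mul_le_mul_of_nonneg_right _ hH0.le
          exact mul_le_mul_of_nonneg_right (le_max_left _ _) hrate0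
  · -- small `X`: trivial bound
    have hbound : ∀ x ∈ Set.uIoc (0 : ℝ) X, ‖(‖∑ n ∈ Finset.Icc ⌈x⌉₊ ⌊x + H⌋₊,
        L n * ξ n * Complex.exp (2 * Real.pi * Complex.I * (α : ℂ) * (n : ℂ))‖)‖ ≤ H + 1 := by
      intro x hx
      rw [Set.uIoc_of_le hX0.le] at hx
      rw [norm_norm]
      refine (norm_sum_le _ _).trans ?_
      calc ∑ n ∈ Finset.Icc ⌈x⌉₊ ⌊x + H⌋₊,
            ‖L n * ξ n * Complex.exp (2 * Real.pi * Complex.I * (α : ℂ) * (n : ℂ))‖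
          ≤ ∑ n ∈ Finset.Icc ⌈x⌉₊ ⌊x + H⌋₊, (1 : ℝ) := by
            refine sum_le_sum fun n _ => ?_
            rw [norm_mul, ← hg n]
            have he : ‖Complex.exp (2 * Real.pi * Complex.I * (α : ℂ) * (n : ℂ))‖ = 1 := by
              have : 2 * Real.pi * Complex.I * (α : ℂ) * (n : ℂ) = ((2 * Real.pi * α * n : ℝ) : ℂ) * I := by
                push_cast
                ring
              rw [this, Complex.norm_exp_ofReal_mul_I]
            rw [he, mul_one]
            exact hg1 n
        _ = #(Finset.Icc ⌈x⌉₊ ⌊x + H⌋₊) := by simp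
        _ ≤ H + 1 := Tao2016.card_Icc_ceil_floor_le hx.1.le hH0.le
    have h1 := intervalIntegral.norm_integral_le_of_norm_le_const hbound
    rw [Real.norm_eq_abs, sub_zero, abs_of_pos hX0] at h1
    have h2 : ∫ x in (0 : ℝ)..X, ‖∑ n ∈ Finset.Icc ⌈x⌉₊ ⌊x + H⌋₊,
        L n * ξ n * Complex.exp (2 * Real.pi * Complex.I * (α : ℂ) * (n : ℂ))‖ ≤ (H + 1) * X :=
      (le_abs_self _).trans h1
    have hlogle : Real.log X ≤ Real.log X₁ := Real.log_le_log hX0 hXX₁.le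
    have hr : 1 ≤ Real.log X₁ ^ (1 / 700 : ℝ) * (1 / Real.log X ^ (1 / 700 : ℝ)) := by
      rw [mul_one_div, le_div_iff₀ (Real.rpow_pos_of_pos hlogX _), one_mul]
      exact Real.rpow_le_rpow hlogX.le hlogle (by norm_num)
    calc ∫ x in (0 : ℝ)..X, ‖∑ n ∈ Finset.Icc ⌈x⌉₊ ⌊x + H⌋₊,
          L n * ξ n * Complex.exp (2 * Real.pi * Complex.I * (α : ℂ) * (n : ℂ))‖
        ≤ (H + 1) * X := h2
      _ ≤ 2 * H * X := by nlinarith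
      _ ≤ 2 * H * X * (Real.log X₁ ^ (1 / 700 : ℝ) * (1 / Real.log X ^ (1 / 700 : ℝ))) :=
          le_mul_of_one_le_right (by positivity) hr
      _ = (2 * Real.log X₁ ^ (1 / 700 : ℝ)) * (1 / Real.log X ^ (1 / 700 : ℝ)) * H * X := by ring
      _ ≤ K * (Real.log (Real.log H) / Real.log H + 1 / Real.log X ^ (1 / 700 : ℝ)) * H * X := by
          apply mul_le_mul_of_nonneg_right _ hX0.le
          apply mul_le_mul_of_nonneg_right _ hH0.le
          exact mul_le_mul (le_max_right _ _) hrate1 (by positivity)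
            (le_trans (by positivity) (le_max_right _ _))

/-- **Matomäki–Radziwiłł for `λξ`, qualitative form** (as used in Teräväinen 2024, §5.4, Case 1,
"for `X` large enough in terms of `H'`"): for every `δ > 0` there is `H₀` such that for every
`H ≥ H₀` there is `X₀` with
`∫_0^X |∑_{x≤n≤x+H} λ(n) ξ(n) e(αn)| dx ≤ δ H X` for all `X ≥ X₀` and all real `α`.
[cite: Teravainen2024, §5.4 (proof of Proposition 5.4, Case 1), for g = λ] -/
theorem liouville_mul_char_shortSum_integral_small {r : ℕ} [NeZero r]
    (ξ : DirichletCharacter ℂ r) {δ : ℝ} (hδ : 0 < δ) :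
    ∃ H₀ : ℝ, ∀ H : ℝ, H₀ ≤ H → ∃ X₀ : ℝ, ∀ X : ℝ, X₀ ≤ X → ∀ α : ℝ,
      ∫ x in (0 : ℝ)..X, ‖∑ n ∈ Finset.Icc ⌈x⌉₊ ⌊x + H⌋₊,
          (ArithmeticFunction.liouville : ArithmeticFunction ℂ) n * ξ n *
            Complex.exp (2 * Real.pi * Complex.I * (α : ℂ) * (n : ℂ))‖ ≤ δ * H * X := by
  obtain ⟨C, hC⟩ := liouville_mul_char_shortSum_integral_le ξ
  set C' : ℝ := max C 1 with hC'
  have hC'0 : 0 < C' := lt_of_lt_of_le one_pos (le_max_right _ _)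
  -- `log log H / log H → 0`
  have hlim : Tendsto (fun H : ℝ => Real.log (Real.log H) / Real.log H) atTop (nhds 0) :=
    Real.isLittleO_log_id_atTop.tendsto_div_nhds_zero.comp Real.tendsto_log_atTop
  have e1 : ∀ᶠ H : ℝ in atTop, Real.log (Real.log H) / Real.log H ≤ δ / (2 * C') :=
    (hlim.eventually (ge_mem_nhds (by positivity)))
  have e2 : ∀ᶠ H : ℝ in atTop, (10 : ℝ) ≤ H := eventually_ge_atTop 10
  obtain ⟨H₀, hH₀⟩ := (e1.and e2).exists_forall_of_atTop
  refine ⟨H₀, fun H hH => ?_⟩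
  obtain ⟨hH1, hH10⟩ := hH₀ H hH
  -- `X` large: `X ≥ H`, `1/log^{1/700} X ≤ δ/(2C')`, `r log⁵ H ≤ log^{1/125} X`
  have f1 : ∀ᶠ X : ℝ in atTop, H ≤ X := eventually_ge_atTop H
  have hlogpow : Tendsto (fun X : ℝ => Real.log X ^ (1 / 700 : ℝ)) atTop atTop :=
    (tendsto_rpow_atTop (by norm_num : (0 : ℝ) < 1 / 700)).comp Real.tendsto_log_atTop
  have f2 : ∀ᶠ X : ℝ in atTop, 1 / Real.log X ^ (1 / 700 : ℝ) ≤ δ / (2 * C') := by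
    have h := hlogpow.eventually (eventually_ge_atTop (2 * C' / δ))
    have h' := hlogpow.eventually (eventually_gt_atTop (0 : ℝ))
    filter_upwards [h, h'] with X hX hX'
    rw [div_le_div_iff₀ hX' (by positivity)]
    rw [div_le_iff₀ hδ] at hX
    linarith
  have f3 : ∀ᶠ X : ℝ in atTop, (r : ℝ) * Real.log H ^ (5 : ℝ) ≤ Real.log X ^ (1 / 125 : ℝ) :=
    ((tendsto_rpow_atTop (by norm_num : (0 : ℝ) < 1 / 125)).comp Real.tendsto_log_atTop).eventually
      (eventually_ge_atTop _)
  obtain ⟨X₀, hX₀⟩ := (f1.and (f2.and f3)).exists_forall_of_atTop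
  refine ⟨X₀, fun X hX α => ?_⟩
  obtain ⟨hHX, hX2, hX3⟩ := hX₀ X hX
  have hH0 : 0 < H := by linarith
  have hX0 : 0 < X := by linarith
  refine (hC H X hH10 hHX hX3 α).trans ?_
  have hrate : Real.log (Real.log H) / Real.log H + 1 / Real.log X ^ (1 / 700 : ℝ) ≤ δ / C' := by
    have : δ / (2 * C') + δ / (2 * C') = δ / C' := by field_simp; ring
    linarith
  have hrate0 : 0 ≤ Real.log (Real.log H) / Real.log H + 1 / Real.log X ^ (1 / 700 : ℝ) := by
    have hlogH1 : 1 ≤ Real.log H := by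
      rw [← Real.log_exp 1]
      exact Real.log_le_log (Real.exp_pos 1) (by have := Real.exp_one_lt_three; linarith)
    have : 0 ≤ Real.log (Real.log H) := Real.log_nonneg hlogH1
    have hlogX : 0 < Real.log X := Real.log_pos (by linarith)
    positivity
  calc C * (Real.log (Real.log H) / Real.log H + 1 / Real.log X ^ (1 / 700 : ℝ)) * H * X
      ≤ C' * (Real.log (Real.log H) / Real.log H + 1 / Real.log X ^ (1 / 700 : ℝ)) * H * X := by
        apply mul_le_mul_of_nonneg_right _ hX0.le
        apply mul_le_mul_of_nonneg_right _ hH0.le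
        exact mul_le_mul_of_nonneg_right (le_max_left _ _) hrate0
    _ ≤ C' * (δ / C') * H * X := by
        apply mul_le_mul_of_nonneg_right _ hX0.le
        apply mul_le_mul_of_nonneg_right _ hH0.le
        exact mul_le_mul_of_nonneg_left hrate hC'0.le
    _ = δ * H * X := by
        field_simp

end Teravainen2024

end Literature.NumberTheory.Sieve
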